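import Summits.BirchSwinnertonDyer.BirchSwinnertonDyer.Theorems.ErratumRoadFiveNonSurjCornerKolyJProp44StandingInputs
import Summits.BirchSwinnertonDyer.Rank1Residual.X11b.KolyvaginClassChoiceConcrete
import HarnessLib

/-!
# The concrete class `c_M(n)` of a Kolyvagin–Heegner datum does not depend on the auxiliary choices, up to a unit — at a
# ZHANG–Kolyvagin level, for ONE level (cell `bsd-stepL`, seat `bsd-stepL-corner-p1` g10;
# `--supports stmt-BirchSwinnertonDyer-19947`; memo CORNER-G10 §3)

WHY/WHAT. x11b3's `KolyvaginChoice.kolyvaginClass_eq_smul_of_sameLevel` (X11b/KolyvaginClassChoiceConcrete): two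
`KolyvaginHeegnerData` at the same level have Kolyvagin classes differing by a unit of `ℤ/p^M` (Gross 1991, §4 after
(4.1): *"`[P_n]` is independent of the choice of `S`, and depends on the choice of generators `σ_ℓ` … only up to scaling
by `(ℤ/pℤ)^×`"*; the embeddings differ by `Γ_K`, trivial on `H¹(K,·)`). It is keyed on GROSS primes at level `p^M` and
on a FAMILY on the divisors of one level. Here the SAME theorem at a Zhang–Kolyvagin level, for ONE level, image-free:
the Prop. 3.6 package (`hgen`, `hPt`, `Tr_q y ∈ p^M E(K[n])`) comes from this seat's
`Prop44.toGeomPoints_derivedPoint_mem_invPoints` machinery (auxiliary `y(n/q)` from koly's print-free existence, Zhang's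
index for (3.3)); the group-ring half is x11b3's FILE A `exists_isCoprime_kolyvaginPoint_sub_smul_mem`; the rest
verbatim. USE: the compatibility binders of the typed Prop. 4.4 fact (and of this seat's kernel Prop. 4.4) can be
DROPPED — `…Prop44AnyPair`. HONEST FRAMING: plumbing; labelled {`hA`} (admissibility — a theorem under (irr));
nothing about BSD; no stub closes; T7. References: [GrossLMS1991] §3 end, §4 (4.1) and the sentence after it, Prop.
3.6, Lemma 4.3; [McCallumLMS1991] §4 (4)–(6); [SerreLocalFields1979] VII §5 Prop. 3; [WZhang2014] Notations (xii).
-/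

set_option autoImplicit false
set_option linter.dupNamespace false

noncomputable section

open scoped Classical
open WeierstrassCurve Field NumberField IsDedekindDomain Finset
open Literature.NumberTheory.EllipticCurves Literature.NumberTheory.GaloisRepresentations
open Literature.NumberTheory.EllipticCurves.KolyvaginCocycle
open Literature.NumberTheory.EllipticCurves.KolyvaginEuler
open Literature.NumberTheory.EllipticCurves.RingClassField
open Literature.NumberTheory.EllipticCurves.ModularForms
open Summit.BirchSwinnertonDyer.Rank1Residual.X11b
open Summit.BirchSwinnertonDyer.Rank1Residual.X11b.KolyvaginH44
open Summit.BirchSwinnertonDyer.Rank1Residual.X11b.KolyvaginChoice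
open Summit.BirchSwinnertonDyer.Rank1Residual.X11b.Three.Koly

namespace Summit.BirchSwinnertonDyer.BirchSwinnertonDyer.Theorems.Prop44

-- `K : Type`: the tree's ring-class class field theory is universe `0`.
variable {K : Type} [Field K] [NumberField K] {W : WeierstrassCurve ℚ} [W.IsElliptic] [W.IsGloballyMinimal]
  [NeZero (W.conductorNorm ℤ)]

set_option maxHeartbeats 1600000 in
/-- **`c'_M(n) = u · c_M(n)`, `u` prime to `p`, for two Kolyvagin–Heegner data at the same Zhang–Kolyvagin level.** For `K`
imaginary quadratic with `d_K < −4` and the Heegner hypothesis for `N_E`, a frame `(Dt, β, ι)`, `p` prime, `M ≥ 1`, `n`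
square-free with Zhang–Kolyvagin prime factors of index `≥ M`, two data `d₁ d₂ : KolyvaginHeegnerData Dt β ι n` and
`E(K[n]) ⊆ E(K̄)` admissible for `p^M` (`hA`, for `d₁`): there is `u ∈ ℤ` prime to `p` with
`d₂.kolyvaginClass = u • d₁.kolyvaginClass` in `H¹(K, E[p^M])` (x11b3's `kolyvaginClass_eq_smul_of_sameLevel`, Zhang
re-key, one level). [cite: GrossLMS1991, §4 (4.1) (the sentence after it), Prop. 3.6, Lemma 4.3]
[cite: McCallumLMS1991, §4 (4)–(6)] [cite: WZhang2014, Notations (xii)] -/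
theorem kolyvaginClass_eq_smul_of_sameLevel (hK : IsImaginaryQuadratic K) (ι : K →+* ℂ)
    (hD : NumberField.discr K < -4) (hH : SatisfiesHeegnerHypothesis (W.conductorNorm ℤ) K)
    (Dt : ModularParametrizationData W (W.conductorNorm ℤ)) {β : ℤ} {p M : ℕ} (hp : p.Prime) (hM : 1 ≤ M)
    {n : ℕ} (hn : Squarefree n)
    (hkol : ∀ q ∈ n.primeFactors, Zhang2014.IsKolyvaginPrime (W.conductorNorm ℤ) W K p q ∧
      M ≤ Zhang2014.kolyvaginIndex W p q)
    (d₁ d₂ : KolyvaginHeegnerData Dt β ι n)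
    (hA : IsAdmissible (absoluteGaloisGroup K) d₁.pointsSubgroup ((p ^ M : ℕ) : ℤ)) :
    ∃ u : ℤ, IsCoprime u (p : ℤ) ∧ d₂.kolyvaginClass hp M = u • d₁.kolyvaginClass hp M := by
  letI : Algebra K ℂ := ι.toAlgebra
  haveI : Fact p.Prime := ⟨hp⟩
  set N : ℕ := W.conductorNorm ℤ with hNdef
  have hn0 : n ≠ 0 := Squarefree.ne_zero hn
  have hinert : ∀ q ∈ n.primeFactors, (Ideal.span {(q : 𝓞 K)}).IsPrime :=
    fun q hq ↦ (hkol q hq).1.2.2.2.2.1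
  have hND : IsCoprime (N : ℤ) (NumberField.discr K) :=
    KolyvaginAssembly.isCoprime_discr_of_satisfiesHeegnerHypothesis hK hH
  have hNn : Nat.Coprime N n :=
    KolyvaginH37Bridge.coprime_of_forall_not_dvd hn0 fun q hq ↦ (hkol q hq).1.2.1
  have hdiv : ∀ Q : geomPoints (W.baseChange K), ∃ R, ((p ^ M : ℕ) : ℤ) • R = Q :=
    (W.baseChange K).zsmul_geomPoints_surjective_of_charZero
      (by exact_mod_cast pow_ne_zero M hp.ne_zero)
  -- the level data of `d₁` (generators, point, restriction, embedding); the sections are chosen below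
  obtain ⟨σ, H₀, f₀, y, π, j, e, hord, hj, hπρ, hfsec₀, hHρ₀, hdict, hjunk⟩ :=
    exists_levelData_of (W := W) (Dt := Dt) (β := β) hK ι (fun k ↦ k = n) (fun k (hk : k = n) ↦ hk ▸ hn)
      (fun k (hk : k = n) ↦ hk ▸ hinert) (fun k (hk : k = n) ↦ hk ▸ d₁) n
  obtain ⟨hjd, hyd, hσd, -⟩ := hdict rfl
  letI hcg : CommGroup (ringClassGal ι n) :=
    { (inferInstance : Group (ringClassGal ι n)) with
      mul_comm := fun a b ↦ (isMulCommutative_ringClassGal' hK ι n).is_comm.comm a b }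
  haveI hfin : Finite (ringClassGal ι n) := finite_ringClassGal hK ι n
  letI act : DistribMulAction (ringClassGal ι n) ((W.baseChange (ringClassField K ι n)).toAffine.Point) :=
    DistribMulAction.compHom _ ((pointGalHom W (ringClassField K ι n)).comp (ringClassGal ι n).subtype)
  set ρ : ringClassGal ι n →* (ringClassField K ι n ≃ₐ[ℚ] ringClassField K ι n) :=
    (ringClassGal ι n).subtype with hρdef
  have hρ : Function.Injective ρ := (ringClassGal ι n).subtype_injective
  have hsmul : ∀ (g : ringClassGal ι n) (Q : (W.baseChange (ringClassField K ι n)).toAffine.Point),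
      g • Q = pointGalHom W (ringClassField K ι n) (ρ g) Q := fun _ _ ↦ rfl
  have hσq : ∀ q ∈ n.primeFactors, ρ (σ q) = d₁.σ q := fun q hq ↦ hσd q hq
  -- the subgroup `H = Gal(K[n]/K[1])` pulled back to `𝒢_n`, and sections valued in the two transversals
  set Hc : Subgroup (ringClassGal ι n) := (ringClassGalOver ι n 1).comap (ringClassGal ι n).subtype with hHc
  letI hft : Fintype (ringClassGal ι n ⧸ Hc) := Fintype.ofFinite _
  have hHρ : ∀ h ∈ Hc, ρ h ∈ ringClassGalOver ι n 1 := fun h hh ↦ Subgroup.mem_comap.mp hh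
  obtain ⟨f, hfsec, hfS⟩ := d₁.exists_section_of_transversal
  obtain ⟨f', hf'sec, hf'S⟩ := d₂.exists_section_of_transversal
  -- Prop. 3.6 package for `d₁`: `hgen`, `p^M ∣ q + 1`, `Tr_q y ∈ p^M E(K[n])`
  have hgen : Hc ≤ Subgroup.closure (σ '' ((n.primeFactors : Finset ℕ) : Set ℕ)) := by
    intro h hh
    have h1 := RingClassTower.ringClassGalOver_one_le_iSup hK ι hn (hHρ h hh)
    have h2 : (⨆ q ∈ n.primeFactors, ringClassGalOver ι n (n / q)) ≤
        (Subgroup.closure (σ '' (n.primeFactors : Set ℕ))).map ρ := by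
      refine iSup₂_le fun q hq ↦ ?_
      rw [← d₁.zpowers_σ q hq, ← hσq q hq, ← MonoidHom.map_zpowers]
      exact Subgroup.map_mono (Subgroup.zpowers_le.mpr
        (Subgroup.subset_closure ⟨q, Finset.mem_coe.mpr hq, rfl⟩))
    obtain ⟨g, hg, hgh⟩ := Subgroup.mem_map.mp (h2 h1)
    rwa [← hρ hgh]
  have hdvd : ∀ q ∈ n.primeFactors, ((p ^ M : ℕ) : ℤ) ∣ ((q + 1 : ℕ) : ℤ) := by
    intro q hq
    obtain ⟨h1, -⟩ := Zhang2014.le_kolyvaginIndex_iff.mp (hkol q hq).2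
    exact_mod_cast h1
  have htr : ∀ q ∈ n.primeFactors, grAct _ (traceElt (σ q) q) y ∈
      zsmulRange ((W.baseChange (ringClassField K ι n)).toAffine.Point) ((p ^ M : ℕ) : ℤ) := by
    intro q hq
    obtain ⟨hqp, hqn, -⟩ := Nat.mem_primeFactors.mp hq
    haveI : Fact q.Prime := ⟨hqp⟩
    have hqn' : ¬ q ∣ n / q := not_dvd_div_of_squarefree_of_prime hn hqp hqn
    have hle : ringClassField K ι (n / q) ≤ ringClassField K ι n :=
      ringClassField_mono hK ι (Nat.div_dvd_of_dvd hqn) hn0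
    obtain ⟨dq⟩ := nonempty_kolyvaginHeegnerData_printFree hK hH Dt β ι d₁.dvd_sq_sub
      (hn.squarefree_of_dvd (Nat.div_dvd_of_dvd hqn))
      (fun r hr ↦ hinert r (Nat.primeFactors_mono (Nat.div_dvd_of_dvd hqn) hn0 hr))
    have hgood : W.HasGoodReductionAtPrime q :=
      KolyvaginH37Bridge.hasGoodReductionAtPrime_of_modularParametrizationData Dt (hkol q hq).1.2.1
    have htr' := HeegnerTrace.frobeniusTrace_smul_eq_of_lFunction_smul_eq hgood
      (HeegnerTrace.sum_pow_pointGalHom_y_eq_lFunction_smul_map hK ι hND hq (hinert q hq) (hkol q hq).1.2.1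
        hqn' hNn (Or.inr hD) d₁ dq hle)
    have haq : ((p ^ M : ℕ) : ℤ) ∣ W.frobeniusTrace q := by
      obtain ⟨-, h2⟩ := Zhang2014.le_kolyvaginIndex_iff.mp (hkol q hq).2
      exact_mod_cast h2
    refine grAct_traceElt_mem_of_eq_smul
      (y' := WeierstrassCurve.Affine.Point.map (W' := W) ((RingClassField.inclusion ι hle).restrictScalars ℚ) dq.y)
      ?_ haq
    rw [grAct_traceElt]
    simp_rw [hsmul, map_pow ρ, hσq q hq, hyd]
    exact htr'
  -- `q ≠ 0`, `orderOf σ_q = q + 1`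
  have hL : ∀ q ∈ n.primeFactors, q ≠ 0 := fun q hq ↦ (Nat.prime_of_mem_primeFactors hq).ne_zero
  have horder : ∀ q ∈ n.primeFactors, orderOf (σ q) = q + 1 := by
    intro q hq
    obtain ⟨hqp, hqn, -⟩ := Nat.mem_primeFactors.mp hq
    have hqn' : ¬ q ∣ n / q := not_dvd_div_of_squarefree_of_prime hn hqp hqn
    rw [← orderOf_injective ρ hρ (σ q), hσq q hq]
    exact RingClassTower.orderOf_eq_succ_of_zpowers_eq_ringClassGalOver hK ι hqp (hinert q hq) hqn hqn' hn0
      (Or.inr hD) (d₁.zpowers_σ q hq)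
  -- the second datum's generators, inside `𝒢_n`
  have hσ'mem : ∀ q ∈ n.primeFactors, d₂.σ q ∈ ringClassGal ι n := fun q hq ↦
    ringClassGalOver_le_ringClassGal ι n (n / q) ((d₂.zpowers_σ q hq) ▸ Subgroup.mem_zpowers _)
  let σ' : ℕ → ringClassGal ι n := fun q ↦
    if hq : q ∈ n.primeFactors then ⟨d₂.σ q, hσ'mem q hq⟩ else 1
  have hσ'A : ∀ q ∈ n.primeFactors, ρ (σ' q) = d₂.σ q := fun q hq ↦ by
    simp only [σ', dif_pos hq]
    rfl
  have hz : ∀ q ∈ n.primeFactors, Subgroup.zpowers (σ' q) = Subgroup.zpowers (σ q) := by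
    intro q hq
    apply Subgroup.map_injective hρ
    rw [MonoidHom.map_zpowers, MonoidHom.map_zpowers, hσ'A q hq, hσq q hq, d₂.zpowers_σ q hq,
      d₁.zpowers_σ q hq]
  -- FILE A: `P'(n) − u · P(n) ∈ p^M E(K[n])`
  obtain ⟨u, hu, hmem⟩ := exists_isCoprime_kolyvaginPoint_sub_smul_mem hfsec hf'sec hgen hL
    horder hz hdvd htr
  -- G1: the abstract Kolyvagin points ARE `P(n)`, `P'(n)`
  have hbij := KolyvaginH37Bridge.bijOn_of_section_of_transversal ρ hρ
    (H := Hc) (Γ := ringClassGal ι n) (G₁ := ringClassGalOver ι n 1) hHρ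
    (S := (d₁.S : Set _)) (fun s hs ↦ d₁.S_subset s hs)
    (fun s hs ↦ ⟨⟨s, d₁.S_subset s hs⟩, rfl⟩) d₁.S_transversal f hfsec hfS
  have hbij' := KolyvaginH37Bridge.bijOn_of_section_of_transversal ρ hρ
    (H := Hc) (Γ := ringClassGal ι n) (G₁ := ringClassGalOver ι n 1) hHρ
    (S := (d₂.S : Set _)) (fun s hs ↦ d₂.S_subset s hs)
    (fun s hs ↦ ⟨⟨s, d₂.S_subset s hs⟩, rfl⟩) d₂.S_transversal f' hf'sec hf'S
  have hyk' : y = d₂.y := by rw [hyd, y_eq d₁ d₂]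
  have hP : kolyvaginPoint σ n.primeFactors f y = d₁.derivedPoint := by
    rw [hyd]
    exact KolyvaginH37Bridge.map_kolyvaginPoint_eq_derivedPoint
      (pointGalHom W (ringClassField K ι n)) ρ (AddMonoidHom.id _) (fun g a ↦ hsmul g a)
      hn hσq f hbij d₁.y
  have hP' : kolyvaginPoint σ' n.primeFactors f' y = d₂.derivedPoint := by
    rw [hyk']
    exact KolyvaginH37Bridge.map_kolyvaginPoint_eq_derivedPoint
      (pointGalHom W (ringClassField K ι n)) ρ (AddMonoidHom.id _) (fun g a ↦ hsmul g a)
      hn hσ'A f' hbij' d₂.y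
  -- `P'(n) = u • P(n) + p^M • b` in `E(K[n])`, pushed to `E(K̄)` along `J = d₁.toGeomPoints`
  obtain ⟨b, hb⟩ := mem_zsmulRange_iff.mp hmem
  rw [hP, hP'] at hb
  have hcongE : d₂.derivedPoint = u • d₁.derivedPoint + ((p ^ M : ℕ) : ℤ) • b := by
    rw [hb]; abel
  have hJcong : d₁.toGeomPoints d₂.derivedPoint =
      u • d₁.toGeomPoints d₁.derivedPoint + ((p ^ M : ℕ) : ℤ) • d₁.toGeomPoints b := by
    rw [hcongE, map_add, map_zsmul, map_zsmul]
  have hJb : d₁.toGeomPoints b ∈ d₁.pointsSubgroup := ⟨b, rfl⟩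
  have hPtJ : d₁.toGeomPoints d₁.derivedPoint ∈
      invPoints (absoluteGaloisGroup K) d₁.pointsSubgroup ((p ^ M : ℕ) : ℤ) :=
    toGeomPoints_derivedPoint_mem_invPoints hK ι hD hH Dt hp hn hkol d₁
  have hPtJ' : d₁.toGeomPoints d₂.derivedPoint ∈
      invPoints (absoluteGaloisGroup K) d₁.pointsSubgroup ((p ^ M : ℕ) : ℤ) := by
    rw [hJcong]
    exact (invPoints _ _ _).add_mem ((invPoints _ _ _).zsmul_mem hPtJ u) (zsmul_mem_invPoints hA hJb)
  -- McCallum's class is additive: `c(u P + p^M b) = u c(P)`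
  have hcls : kolyvaginClass (W.baseChange K) ((p ^ M : ℕ) : ℤ) hdiv hA
        (d₁.toGeomPoints d₂.derivedPoint) hPtJ' =
      u • kolyvaginClass (W.baseChange K) ((p ^ M : ℕ) : ℤ) hdiv hA
        (d₁.toGeomPoints d₁.derivedPoint) hPtJ := by
    set P₀ := d₁.toGeomPoints d₁.derivedPoint with hP₀
    set B₀ := d₁.toGeomPoints b with hB₀
    set Q := Classical.choose (hdiv P₀) with hQdef
    have hQ : ((p ^ M : ℕ) : ℤ) • Q = P₀ := Classical.choose_spec (hdiv P₀)
    have hεP : u • P₀ ∈ invPoints (absoluteGaloisGroup K) d₁.pointsSubgroup ((p ^ M : ℕ) : ℤ) :=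
      (invPoints _ _ _).zsmul_mem hPtJ u
    have hεQ : ((p ^ M : ℕ) : ℤ) • (u • Q) = u • P₀ := by rw [smul_comm, hQ]
    have hP'' : u • P₀ + ((p ^ M : ℕ) : ℤ) • B₀ ∈
        invPoints (absoluteGaloisGroup K) d₁.pointsSubgroup ((p ^ M : ℕ) : ℤ) := by
      rw [← hJcong]; exact hPtJ'
    have hQ'' : ((p ^ M : ℕ) : ℤ) • (u • Q + B₀) = u • P₀ + ((p ^ M : ℕ) : ℤ) • B₀ := by
      rw [zsmul_add, hεQ]
    have h1 : kolyvaginClass (W.baseChange K) ((p ^ M : ℕ) : ℤ) hdiv hA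
          (d₁.toGeomPoints d₂.derivedPoint) hPtJ' =
        cls hA (continuous_smul_geomPoints _) hP'' hQ'' := by
      have hQ''' : ((p ^ M : ℕ) : ℤ) • (u • Q + B₀) = d₁.toGeomPoints d₂.derivedPoint := by
        rw [hQ'', hJcong]
      rw [kolyvaginClass_eq_cls hA hPtJ' hQ''']
      exact cls_congr hA _ hJcong rfl
    rw [h1, cls_add_zsmul hA _ hεP hεQ hJb hP'' hQ'', cls_zsmul hA _ hPtJ hQ u hεP hεQ,
      kolyvaginClass_eq_cls hA hPtJ hQ]
  -- the embeddings differ by `γ ∈ Γ_K`; same image; `c(γ • P) = c(P)`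
  obtain ⟨γ, hγ⟩ := exists_toGeomPoints_eq_smul d₁ d₂
  have hAeq : d₂.pointsSubgroup = d₁.pointsSubgroup := pointsSubgroup_eq hK d₁ d₂
  have hA' : IsAdmissible (absoluteGaloisGroup K) d₂.pointsSubgroup ((p ^ M : ℕ) : ℤ) := hAeq ▸ hA
  have hPtγ : γ • d₁.toGeomPoints d₂.derivedPoint ∈
      invPoints (absoluteGaloisGroup K) d₁.pointsSubgroup ((p ^ M : ℕ) : ℤ) :=
    smul_mem_invPoints hA γ hPtJ'
  have hPt' : d₂.toGeomPoints d₂.derivedPoint ∈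
      invPoints (absoluteGaloisGroup K) d₂.pointsSubgroup ((p ^ M : ℕ) : ℤ) := by
    rw [hγ, hAeq]; exact hPtγ
  refine ⟨u, ?_, ?_⟩
  · have hu' : IsCoprime u ((p : ℤ) ^ M) := by exact_mod_cast hu
    exact (IsCoprime.pow_right_iff hM).mp hu'
  · rw [d₂.kolyvaginClass_of_admissible hp M hA' hPt',
      d₁.kolyvaginClass_of_admissible hp M hA hPtJ,
      KolyvaginH44.kolyvaginClass_congr (hdiv' := hdiv) (hA' := hA) (hP' := hPtγ) hAeq (hγ _),
      kolyvaginClass_smul_eq hA γ hPtJ' hPtγ, hcls]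

/-- **Memberships of multiples of `c_M(n)` are blind to the auxiliary choices**: for any subgroup `H` of `H¹(K, E[p^M])`
(printed: `Sel_λ`, the local kernels) and any `t` (printed: `p^j`), `t • c'_M(n) ∈ H ↔ t • c_M(n) ∈ H` (the classes
differ by a unit of `ℤ/p^M`). [cite: GrossLMS1991, §4 (4.1)] [cite: McCallumLMS1991, §4 (4)–(6), Prop. 4.4] -/
theorem zsmul_kolyvaginClass_mem_iff_of_sameLevel (hK : IsImaginaryQuadratic K) (ι : K →+* ℂ)
    (hD : NumberField.discr K < -4) (hH : SatisfiesHeegnerHypothesis (W.conductorNorm ℤ) K)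
    (Dt : ModularParametrizationData W (W.conductorNorm ℤ)) {β : ℤ} {p M : ℕ} (hp : p.Prime) (hM : 1 ≤ M)
    {n : ℕ} (hn : Squarefree n)
    (hkol : ∀ q ∈ n.primeFactors, Zhang2014.IsKolyvaginPrime (W.conductorNorm ℤ) W K p q ∧
      M ≤ Zhang2014.kolyvaginIndex W p q)
    (d₁ d₂ : KolyvaginHeegnerData Dt β ι n)
    (hA : IsAdmissible (absoluteGaloisGroup K) d₁.pointsSubgroup ((p ^ M : ℕ) : ℤ))
    (H : AddSubgroup (galH1Torsion (W.baseChange K) ((p ^ M : ℕ) : ℤ))) (t : ℤ) :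
    t • d₂.kolyvaginClass hp M ∈ H ↔ t • d₁.kolyvaginClass hp M ∈ H := by
  obtain ⟨u, hu, he⟩ := kolyvaginClass_eq_smul_of_sameLevel hK ι hD hH Dt hp hM hn hkol d₁ d₂ hA
  have hu' : IsCoprime u ((p ^ M : ℕ) : ℤ) := by
    rw [Nat.cast_pow]
    exact (IsCoprime.pow_right_iff hM).mpr hu
  exact zsmul_mem_iff_of_isCoprime hu' (zsmul_galH1Torsion_eq_zero (W.baseChange K) _ _) he t

end Summit.BirchSwinnertonDyer.BirchSwinnertonDyer.Theorems.Prop44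

end
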